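import Summits.QuantumFields.BalabanUV.T4Continuum.Spine.NE1p.DressedSmallFieldShape

/-!
# T⁴ programme, spine estimate NE1′ (node O3b/H2) — THE DRESSED TABLE OF A FAMILY OF BIRTHS: binder (B2) of the small-field
# half («the dressed potential table is analytic in the source, inside the dressed ball») DISCHARGED into (w1) births + their
# sizes + the bound of the «Lemma 1» map, and a decided toy on which the WHOLE μ-part END fires (every socket of the births END —
# incl. the B13 geometry shapes `Ineq126` ∕ `VolBound` ∕ `Ineq227` at `Finset.univ` and the clauses — jointly inhabited)

Cell `pub-balaban`, sub-cell `t4`, BINDER-OWNERS row NE1′; owner lineage t4-ne1p-p1 (PROVER seat P1, «RG-trajectory comparison …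
term by term with the observable insertion, tracking μ-uniformity through the printed small-field bounds»), generation 26;
ADDITIVE — imports `Spine/NE1p/DressedSmallFieldShape` (N0k, p220184) ONLY; THEOREMS ONLY (+ one `example`).  VERSIONS: v1 p220539
(commit 656f0d98a283); v1.1 DOC-ONLY (the «first inhabited instance» sentences of v1 corrected per typer R-T89 (f); every
declaration byte-identical to v1).

WHY THIS FILE.  After N0j `DressedSmallFieldPencil` (p220020) and N0k `DressedSmallFieldShape` (p220184) the small-field half of
PAY∕allowance and (w5)'s constant read: μ-part ∕ envelope ∕ holomorphy ∕ regeneration ⇐ (B1) `hrep` (the (2.14)-shape of the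
dressed activities with μ-free data) ∧ (B2) `hV`∕`hVR` (the dressed table `μ ↦ 𝐕_k(μ)` complex differentiable on the source disc
with values in the dressed ball) ∧ (B3) `hL3` (Lemma 3 at the dressed constant = GAPS G-ne9p2-5) ∧ (B4) B13 geometry ∧ (B5)
clauses.  The owner's located READING (memo `OWNER-ANSWERS-g26.md` §2 (R1)–(R2); [Balaban1988RGII] p. 9 Lemma 1 (1.33)
«𝐄_k(U_k(exp iB′V^{(k)})) − 𝐄_k(U_k(V^{(k)})) = Σ_{Y∈𝐃_k} 𝐕′_k(Y, U_{k+1}, B)» with (1.36) «|𝐕′_k(Y,𝐔,𝐉,B)| ≤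
E₀ε₁C₁M^q exp C₂κ₁ exp(−(1 − 2δ)κd_k(Y))» — a LOCUS of the audited manuscript, TYPE only) is that the old terms enter the
table through a map LINEAR in the old-term functional with a bound proportional to its size; so in the dressed run the table
of births is `μ ↦ V₀ + T (D μ)` with
`T` a bounded linear «Lemma 1» map, `D μ` the observable-attached old-term functional ((w1): analytic in μ; L-B: size `≤ D₀` on
the disc) and `V₀` the undressed table (`‖V₀‖ ≤ ε₁`).  THIS FILE types exactly that and discharges (B2):
* §1 `differentiableOn_table_of_births` — `μ ↦ V₀ + T (D μ)` is complex differentiable where `D` is (a continuous linear map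
  composed with an analytic family); `mapsTo_table_of_births` — with `‖T‖ ≤ t` and `t·D₀ < w` the table lies in the ball of radius
  `ε₁ + w` («E₀ ↦ E₀ + D₀» read through the map).  [folklore]
* §2 `muPart_locE_le_of_births` — N0k's `muPart_locE_le_of_rep` BY NAME with `hV`∕`hVR` FED by §1: the μ-part END
  `‖E_μ(X) − E_0(X)‖ ≤ (e ν c₁ K₀² · A · e^{−r₁ d(X)}) · μ₀/(μ₁ − μ₀)` from `hrep` ∧ (births `hDan`∕`hDsz`, map bound `hT`,
  `hV₀`, `hw`) ∧ `hL3` ∧ geometry ∧ clauses — (B2) no longer appears.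
* §3 NON-VACUITY OF THE WHOLE END — `toy_muPart_of_births`: on a DECIDED toy (polymers = `Finset Unit` = {∅, {()}} over one
  cube with the tree's subset incompatibility `polyInc`; distances 0; (1.26) constant `K₀ = 2` (`toy_ineq126`), volume constant
  `c₁ = 1` (`toy_volBound`), (2.27) trivially (`toy_ineq227`); one Dirac-averaged exp-linear term with prefactor `e^{−3}` and the
  identity functional; births `D s = s` through `T = ½·id`, `V₀ = 1/8`, window `μ₀ = 1/8 < μ₁ = 1/4`, dressed radius `1/2`;
  clause `2e^{−3/2} ≤ 1` (`toy_small`)) EVERY binder of `muPart_locE_le_of_births` is discharged and the END FIRES for any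
  activity table represented in the shape (`hact`, inhabited by `rfl` — the closing `example`).  v1.1 DOCFIX (typer R-T89 (f),
  CLAIMS.log l.14589): v1 called this «the first inhabited instance of the B13 geometry shapes in the tree» — WRONG: `Ineq126` ∕
  `VolBound` ∕ `Ineq227` are already inhabited on a decided toy in `Support/ClusterRepOfDomainsWitness.lean` (`toy_ineq126` ∕
  `toy_volBound` ∕ `toy_ineq227`) and discharged on the torus tree-length geometry in `Support/B13DomainGeometry.lean`
  (`ineq126_domAt` ∕ `volBound_domAt` ∕ `ineq227_dom`) and `Support/B13DomainGeometryTR.lean` (B13 ∕ NE9 lineages; context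
  only, not imported); what §3 does is the JOINT inhabitation of the births END's socket list (geometry at `Finset.univ` +
  clauses + (E1)∕(E2) through `hrep` + births ∕ map ∕ radius + `hL3`) reaching `muPart_locE_le_of_births` BY NAME.  The crew
  row W23 (N0j's own END `muPart_locE_le` on a decided catalogue with LIVE decay, typer R-T89 (i)) is a DIFFERENT witness and
  stays wanted.  A toy decides toy data: nothing about Bałaban's `d_k`, cubes or activities is asserted.

WHAT REMAINS DISPLAYED for the small-field half after N0j + N0k + this file: (B1) `hrep` [READING]; (w1)∕L-B∕(w6) in the form
`hDan`∕`hDsz`∕window + the «Lemma 1» map's bound `hT` [(1.36) TYPE ∝ size; for the cell's D-terms a hypothesis on their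
analyticity domain = (w1)] + `hV₀` [print's (1.36)∕(1.43) at E₀, TYPE]; (B3) `hL3` [= G-ne9p2-5, shared with NE9]; (B4); (B5).
NE1′ NOT printed, NOT proved; 0 leaves instantiated on Bałaban's densities; spine PROVED 0∕9; count 9 unchanged.

HONEST FRAMING.  Kernel bookkeeping ([folklore]: a continuous linear map composed with an analytic family; the triangle
inequality; a decided toy); the printed locus is TYPE∕CONTEXT for the reading, not a fact; ABSOLUTE RULE honoured.  Rung (B)+1 on
ONE finite four-torus — NOT infinite volume, NOT a mass gap, NOT OS on ℝ⁴, NOT Clay.  HONEST DEPENDENCY: continuum YM on T⁴ ⇐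
BetaPertH ∧ nine spine estimates (0/9 proved); BetaPertH ⇐ (D1) ∧ (D4) ∧ CAP+tail; G-an2-4 gates asym, D1 and NE2/3/4.
-/

noncomputable section

namespace Summit.QuantumFields.BalabanUV.T4Continuum.NE1p.DressedTableOfBirths

open MeasureTheory Metric Set Complex
open scoped BigOperators
open Literature.Probability.LatticeModels (polyInc)
open Literature.MathematicalPhysics.QuantumFieldTheory.Balaban1983to89.B13FamilySum (Ineq126 VolBound Ineq227)
open Literature.MathematicalPhysics.QuantumFieldTheory.Balaban1983to89.B13Resummation (locE)
open Summit.QuantumFields.BalabanUV.T4Continuum.NE1p.DressedSmallFieldShape (muPart_locE_le_of_rep)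

variable {Old Pot : Type*} [NormedAddCommGroup Old] [NormedSpace ℂ Old] [NormedAddCommGroup Pot] [NormedSpace ℂ Pot]

/-! ## §1 THE DRESSED TABLE OF A FAMILY OF BIRTHS through a bounded linear «Lemma 1» map -/

/-- **THE DRESSED TABLE IS ANALYTIC WHEN THE BIRTHS ARE** [folklore]: if the observable-attached old-term functional
`μ ↦ D μ` is complex differentiable on a set `S` (valued in a normed space `Old` of old-term functionals) and the «Lemma 1» map
`T : Old →L[ℂ] Pot` is continuous linear, the dressed table `μ ↦ V₀ + T (D μ)` is complex differentiable on `S`. -/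
theorem differentiableOn_table_of_births {T : Old →L[ℂ] Pot} {D : ℂ → Old} {V₀ : Pot} {S : Set ℂ}
    (hD : DifferentiableOn ℂ D S) : DifferentiableOn ℂ (fun μ => V₀ + T (D μ)) S :=
  (differentiableOn_const V₀).add (T.differentiable.comp_differentiableOn hD)

/-- **THE DRESSED RADIUS FROM THE BIRTHS' SIZE AND THE MAP'S BOUND** [folklore]: undressed table `‖V₀‖ ≤ ε₁`, births of size
`‖D μ‖ ≤ D₀` on `S`, map bound `‖T‖ ≤ t` (the (1.36)-type constant per unit of old-term size), and `t·D₀ < w` ⇒ the dressed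
table maps `S` into the ball of radius `ε₁ + w`: the attached part has size `≤ t·D₀` — «E₀ ↦ E₀ + D₀» read through the map. -/
theorem mapsTo_table_of_births {T : Old →L[ℂ] Pot} {D : ℂ → Old} {V₀ : Pot} {S : Set ℂ} {ε₁ D₀ t w : ℝ}
    (hV₀ : ‖V₀‖ ≤ ε₁) (hD : ∀ μ ∈ S, ‖D μ‖ ≤ D₀) (hT : ‖T‖ ≤ t) (hw : t * D₀ < w) :
    MapsTo (fun μ => V₀ + T (D μ)) S (ball (0 : Pot) (ε₁ + w)) := by
  refine DressedSmallFieldShape.mapsTo_dressedTable hV₀ fun μ hμ => ?_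
  calc ‖T (D μ)‖ ≤ ‖T‖ * ‖D μ‖ := T.le_opNorm _
    _ ≤ t * D₀ := mul_le_mul hT (hD μ hμ) (norm_nonneg _) ((norm_nonneg _).trans hT)
    _ < w := hw

/-! ## §2 THE μ-PART OF THE DRESSED SMALL-FIELD OUTPUT FROM THE BIRTHS: (B2) discharged into (w1) + sizes + the map's bound -/

section End

variable {Ω : Type*} [MeasurableSpace Ω]
variable {Dom Cube J : Type*} [DecidableEq Dom] [DecidableEq Cube] [Fintype Dom]
variable (ι : Dom → Dom → Prop) [DecidableRel ι]

/-- **THE μ-PART OF THE DRESSED SMALL-FIELD OUTPUT FROM THE BIRTHS** (kernel; `DressedSmallFieldShape.muPart_locE_le_of_rep` BY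
NAME with its table binders `hV`∕`hVR` DISCHARGED by §1): the dressed activities represented in the (2.14)-shape along the table
`μ ↦ V₀ + T (D μ)` (`hrep`), the births `D` complex differentiable on the source disc with size `≤ D₀` there ((w1) + L-B, binders
`hDan`∕`hDsz`), the «Lemma 1» map bounded by `t` (`hT`, (1.36)-TYPE), `‖V₀‖ ≤ ε₁`, `t·D₀ < w`, ONE Lemma-3 inequality on the
μ-free prefactor data at the dressed radius `ε₁ + w` (`hL3`), B13's geometry and clauses ⇒ for `0 < μ₀ < μ₁`, `‖μ‖ ≤ μ₀`:
`‖E_μ(X) − E_0(X)‖ ≤ (e ν c₁ K₀² · A · e^{−r₁ d(X)}) · μ₀/(μ₁ − μ₀)`. -/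
theorem muPart_locE_le_of_births [Std.Refl ι] [Std.Symm ι] {cubes reach : Dom → Finset Cube} {d : Dom → ℝ}
    {ν' : J → Measure Ω} {pre : J → Ω → ℂ} {lin : J → Ω → (Pot →L[ℂ] ℂ)} {l : J → Ω → ℝ}
    {T : Old →L[ℂ] Pot} {D : ℂ → Old} {V₀ : Pot} {terms : Dom → Finset J} {act : ℂ → Dom → ℂ}
    {A R r₁ κ₀ K₀ c₁ c b ν dX μ₁ μ₀ ε₁ D₀ t w : ℝ} {X : Finset Cube} {μ : ℂ}
    (hloc : ∀ Z Z', ι Z' Z → ∃ q ∈ reach Z, q ∈ cubes Z')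
    (hreach : ∀ Z, ((reach Z).card : ℝ) ≤ ν * (cubes Z).card)
    (hd : ∀ Z, 0 ≤ d Z) (hA : 0 ≤ A) (hK₀ : 0 ≤ K₀) (hc₁ : 0 ≤ c₁) (hν : 0 ≤ ν) (hκ₀ : 0 ≤ κ₀)
    (hr₁ : 0 ≤ r₁) (hc : 0 ≤ c) (hb : r₁ * c ≤ b)
    (h126 : Ineq126 (Finset.univ : Finset Dom) cubes d κ₀ K₀)
    (hvol : VolBound (Finset.univ : Finset Dom) cubes d c₁)
    (h227 : Ineq227 (Finset.univ : Finset Dom) cubes d X dX c)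
    (hrate : r₁ + 2 * κ₀ + 2 ≤ R) (hsmall : A * Real.exp (b + 1) * K₀ * ν * c₁ ≤ 1) (hX : X.Nonempty)
    (hrep : ∀ s ∈ ball (0 : ℂ) μ₁, ∀ Z,
      act s Z = ∑ j ∈ terms Z, ∫ ω, pre j ω * cexp (lin j ω (V₀ + T (D s))) ∂(ν' j))
    (hpre : ∀ j, AEStronglyMeasurable (pre j) (ν' j))
    (hlinw : ∀ j (Q : Pot), AEStronglyMeasurable (fun ω => lin j ω Q) (ν' j)) (hl : ∀ j ω, ‖lin j ω‖ ≤ l j ω)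
    (hint : ∀ j, Integrable (fun ω => ‖pre j ω‖ * Real.exp (l j ω * (ε₁ + w))) (ν' j))
    (hDan : DifferentiableOn ℂ D (ball (0 : ℂ) μ₁)) (hDsz : ∀ s ∈ ball (0 : ℂ) μ₁, ‖D s‖ ≤ D₀)
    (hV₀ : ‖V₀‖ ≤ ε₁) (hT : ‖T‖ ≤ t) (hw : t * D₀ < w)
    (hL3 : ∀ Z, cubes Z ⊆ X →
      ∑ j ∈ terms Z, ∫ ω, ‖pre j ω‖ * Real.exp (l j ω * (ε₁ + w)) ∂(ν' j) ≤ A * Real.exp (-(R * d Z)))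
    (h0 : 0 < μ₀) (h01 : μ₀ < μ₁) (hμ : ‖μ‖ ≤ μ₀) :
    ‖locE ι cubes (act μ) X - locE ι cubes (act 0) X‖ ≤
      Real.exp 1 * ν * c₁ * K₀ ^ 2 * A * Real.exp (-(r₁ * dX)) * (μ₀ / (μ₁ - μ₀)) :=
  muPart_locE_le_of_rep ι (V := fun s => V₀ + T (D s)) hloc hreach hd hA hK₀ hc₁ hν hκ₀ hr₁ hc hb h126 hvol h227 hrate
    hsmall hX hrep hpre hlinw hl hint (differentiableOn_table_of_births hDan)
    (mapsTo_table_of_births hV₀ hDsz hT hw) hL3 h0 h01 hμ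

end End

/-! ## §3 NON-VACUITY OF THE WHOLE END: every binder of `muPart_locE_le_of_births` jointly inhabited on a decided toy
(two polymers `∅, {()}` over ONE cube with the tree's subset incompatibility `polyInc`, distances `0`, (1.26) constant `K₀ = 2`,
one Dirac-averaged exp-linear term with prefactor `e^{−3}`, births `D s = s` through the map `T = ½·id`, `V₀ = 1/8`); the END
FIRES (no estimate asserted).  (v1.1: the B13 geometry shapes themselves were inhabited earlier in
`Support/ClusterRepOfDomainsWitness` ∕ `Support/B13DomainGeometry(TR)` — see the module docstring.) -/

section Toy

/-- (1.26)-shape on the toy: both polymers contain the one cube, `Σ e^{0} = 2 ≤ K₀ = 2`. [folklore] -/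
theorem toy_ineq126 :
    Ineq126 (Finset.univ : Finset (Finset Unit)) (fun _ => ({()} : Finset Unit)) (fun _ => (0 : ℝ)) 0 2 := by
  intro c
  simp

/-- (2.30)-shape on the toy: `#cubes = 1 ≤ 1·(1 + 0)`. [folklore] -/
theorem toy_volBound :
    VolBound (Finset.univ : Finset (Finset Unit)) (fun _ => ({()} : Finset Unit)) (fun _ => (0 : ℝ)) 1 := by
  intro Y _
  simp

/-- (2.27)-shape on the toy (distances and the constant `c` vanish). [folklore] -/
theorem toy_ineq227 :
    Ineq227 (Finset.univ : Finset (Finset Unit)) (fun _ => ({()} : Finset Unit)) (fun _ => (0 : ℝ)) {()} 0 0 := by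
  intro D _
  simp

/-- The toy clause «ε′ small»: `A·e^{b+1}·K₀·ν·c₁ = e^{−3}e^{1/2}·e·2 = 2e^{−3/2} ≤ 1`. [folklore] -/
theorem toy_small : Real.exp (-3) * Real.exp (1 * (1 / 4 + 1 / 4)) * Real.exp (0 + 1) * 2 * 1 * 1 ≤ 1 := by
  have h1 : Real.exp (-3) * Real.exp (1 * (1 / 4 + 1 / 4)) * Real.exp (0 + 1) = Real.exp (-(3 / 2)) := by
    rw [← Real.exp_add, ← Real.exp_add]; norm_num
  have h2 : (2 : ℝ) ≤ Real.exp (3 / 2 : ℝ) := by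
    have := Real.add_one_le_exp (3 / 2 : ℝ); linarith
  have h3 : Real.exp (-(3 / 2 : ℝ)) * 2 ≤ 1 := by
    rw [Real.exp_neg, inv_mul_le_iff₀ (Real.exp_pos _)]; linarith
  calc Real.exp (-3) * Real.exp (1 * (1 / 4 + 1 / 4)) * Real.exp (0 + 1) * 2 * 1 * 1 = Real.exp (-(3 / 2)) * 2 := by
        rw [h1]; ring
    _ ≤ 1 := h3

/-- **THE END FIRES ON THE TOY**: for ANY activity table `act` REPRESENTED in the (2.14)-shape along the toy's table of births
(`hact` — inhabited by `rfl`, see the `example` below), with source window `μ₀ = 1/8 < μ₁ = 1/4`, the μ-part of the dressed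
output on the one cube is bounded by `muPart_locE_le_of_births` — all its binders (`hloc`, `hreach`, positivity, the
(1.26)∕(2.30)∕(2.27) shapes, the clauses, `hrep`, measurability, integrability, births analytic with size `1/4`, map bound `1/2`,
`‖V₀‖ ≤ 1/4`, `t·D₀ < w`, the Lemma-3 inequality at the dressed radius `1/2` (an equality here), the window) DISCHARGED on
decided data. [folklore] -/
theorem toy_muPart_of_births {act : ℂ → Finset Unit → ℂ}
    (hact : ∀ (s : ℂ) (Z : Finset Unit), act s Z = ∑ _j ∈ ({()} : Finset Unit),
      ∫ ω, (fun _ : Unit => ((Real.exp (-3) : ℝ) : ℂ)) ω *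
        cexp ((fun _ : Unit => ContinuousLinearMap.id ℂ ℂ) ω
          ((1 / 8 : ℂ) + ((1 / 2 : ℂ) • ContinuousLinearMap.id ℂ ℂ) ((fun s : ℂ => s) s))) ∂(Measure.dirac ()))
    {μ : ℂ} (hμ : ‖μ‖ ≤ 1 / 8) :
    ‖locE polyInc (fun _ => ({()} : Finset Unit)) (act μ) {()} - locE polyInc (fun _ => ({()} : Finset Unit)) (act 0) {()}‖ ≤
      Real.exp 1 * 1 * 1 * 2 ^ 2 * (Real.exp (-3) * Real.exp (1 * (1 / 4 + 1 / 4))) * Real.exp (-(0 * 0)) *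
        ((1 / 8) / (1 / 4 - 1 / 8)) := by
  refine muPart_locE_le_of_births polyInc (Ω := Unit) (J := Unit) (Old := ℂ) (reach := fun _ => ({()} : Finset Unit))
    (d := fun _ => (0 : ℝ)) (ν' := fun _ => Measure.dirac ()) (pre := fun _ _ => ((Real.exp (-3) : ℝ) : ℂ))
    (lin := fun _ _ => ContinuousLinearMap.id ℂ ℂ) (l := fun _ _ => (1 : ℝ)) (T := (1 / 2 : ℂ) • ContinuousLinearMap.id ℂ ℂ)
    (D := fun s : ℂ => s) (V₀ := (1 / 8 : ℂ)) (terms := fun _ => ({()} : Finset Unit))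
    (A := Real.exp (-3) * Real.exp (1 * (1 / 4 + 1 / 4))) (R := 2) (r₁ := 0) (κ₀ := 0) (K₀ := 2) (c₁ := 1) (c := 0) (b := 0)
    (ν := 1) (dX := 0) (μ₁ := 1 / 4) (μ₀ := 1 / 8) (ε₁ := 1 / 4) (D₀ := 1 / 4) (t := 1 / 2) (w := 1 / 4)
    (fun _ _ _ => ⟨(), by simp, by simp⟩) (fun _ => by simp) (fun _ => le_rfl) (by positivity) (by norm_num) zero_le_one
    zero_le_one le_rfl le_rfl le_rfl (by norm_num) toy_ineq126 toy_volBound toy_ineq227 (by norm_num) toy_small (by simp)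
    (fun s _ Z => hact s Z) (fun _ => aestronglyMeasurable_const) (fun _ _ => aestronglyMeasurable_const)
    (fun _ _ => ContinuousLinearMap.norm_id_le) (fun _ => integrable_const _) differentiableOn_id ?_ (by norm_num) ?_
    (by norm_num) ?_ (by norm_num) (by norm_num) hμ
  · -- births of size ≤ 1/4 on the source disc
    intro s hs
    exact (mem_ball_zero_iff.1 hs).le
  · -- the map's bound ‖½·id‖ ≤ 1/2
    refine (norm_smul_le (1 / 2 : ℂ) (ContinuousLinearMap.id ℂ ℂ)).trans ?_
    have h : ‖(1 / 2 : ℂ)‖ = 1 / 2 := by norm_num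
    rw [h]
    exact mul_le_of_le_one_right (by norm_num) ContinuousLinearMap.norm_id_le
  · -- the Lemma-3 inequality at the dressed radius (an equality on the toy)
    intro Z _
    simp only [Finset.sum_singleton, integral_dirac]
    rw [Complex.norm_real, Real.norm_of_nonneg (Real.exp_nonneg _)]
    simp

/-- The representation binder `hact` of `toy_muPart_of_births` is inhabited (by `rfl`). [folklore] -/
example : ∃ act : ℂ → Finset Unit → ℂ, ∀ (s : ℂ) (Z : Finset Unit), act s Z = ∑ _j ∈ ({()} : Finset Unit),
      ∫ ω, (fun _ : Unit => ((Real.exp (-3) : ℝ) : ℂ)) ω *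
        cexp ((fun _ : Unit => ContinuousLinearMap.id ℂ ℂ) ω
          ((1 / 8 : ℂ) + ((1 / 2 : ℂ) • ContinuousLinearMap.id ℂ ℂ) ((fun s : ℂ => s) s))) ∂(Measure.dirac ()) :=
  ⟨_, fun _ _ => rfl⟩

end Toy

end Summit.QuantumFields.BalabanUV.T4Continuum.NE1p.DressedTableOfBirths

end
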